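import Literature.MathematicalPhysics.KineticTheory.FluctuationSpaceStone
import Literature.MathematicalPhysics.KineticTheory.ZeroWavenumberSpace
import HarnessLib

/-!
# Strong continuity of the Koopman group from its generators' autocorrelations

Topic `Literature/MathematicalPhysics/KineticTheory` (companion of `FluctuationSpaceStone`). The
criterion `FluctuationDynamics.isStronglyContinuous_of_continuousAt_form` asks for continuity at
`t = 0` of the autocorrelation `t ↦ ⟨⟨a, a ∘ φ_t⟩⟩` of EVERY local observable `a ∈ 𝒱`. When `𝒱` is
spanned by the translates and time-evolutes `a ∘ T_x ∘ φ_s` of a set `S` of generators (the natural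
choice of `𝒱` for the infinite chain: `S = {j₀, h₀}`), it suffices to check the generators:
the set of vectors `ψ` with `U_t ψ → ψ` (`t → 0`) is a linear subspace, invariant under every `U_s`
(the `U_t` commute and are continuous) and it contains `[a ∘ T_x] = [a]`; so it contains the class of
every element of the span, whence `⟨⟨b, b ∘ φ_t⟩⟩ = ⟪[b], U_t[b]⟫ → ⟨⟨b, b⟩⟩` for all `b ∈ 𝒱` and
`isStronglyContinuous_of_tendsto_form` applies (`isStronglyContinuous_of_generators`). The chain
instance (`ZeroWavenumberData.isStronglyContinuous_of_generators`) reduces strong continuity on Doyon's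
`ℋ₀(μ)` to continuity at `0` of the two diagonal space-summed correlation functions of `j₀` and `h₀`
whenever `𝒱 ≤ span{j₀ ∘ τ_x ∘ φ_s, h₀ ∘ τ_x ∘ φ_s}`. Everything is proved; tagged `[folklore]`. No
definitions, no named facts.
-/

noncomputable section

open MeasureTheory Filter Set Function
open scoped InnerProductSpace Topology

namespace Literature.MathematicalPhysics.KineticTheory

namespace FluctuationDynamics

variable {G Ω : Type*} [AddCommGroup G] [MeasurableSpace G] [MeasurableSpace Ω]
  {ν : Measure G} {T : ShiftAction G Ω} (D : FluctuationDynamics ν T)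
  [MeasurableNeg G] [ν.IsNegInvariant] [MeasurableAdd G] [ν.IsAddLeftInvariant]
  [ν.IsAddRightInvariant]

/-- The class of a translate-and-evolute `a ∘ T_x ∘ φ_s` of a generator is `U_s [a]`. [folklore] -/
theorem fluct_comp_shift_comp_flow {a : Ω → ℝ} (ha : a ∈ D.localObs) (x : G) (s : ℝ) :
    D.fluct ((a ∘ T x) ∘ D.flow s) = D.koopman s (D.fluct a) := by
  rw [← D.koopman_fluct s (D.comp_shift_mem x ha), FluctuationStructure.fluct_comp_shift x ha]

/-- **Strong continuity from generators.** Let `S ⊆ 𝒱` be a set of local observables whose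
translates and time-evolutes `a ∘ T_x ∘ φ_s` span `𝒱`. If for every generator `a ∈ S` the
autocorrelation `t ↦ ⟨⟨a, a ∘ φ_t⟩⟩` is continuous at `0`, then the Koopman group is strongly
continuous on `ℋ` (the vectors `ψ` with `U_t ψ → ψ` form a linear subspace invariant under every
`U_s`, containing `[a] = [a ∘ T_x]` for `a ∈ S`, hence the class of every element of the span; then
`isStronglyContinuous_of_tendsto_form`). [folklore] -/
theorem isStronglyContinuous_of_generators (S : Set (Ω → ℝ)) (hS : S ⊆ D.localObs)
    (hgen : D.localObs ≤ Submodule.span ℝ {b | ∃ a ∈ S, ∃ (x : G) (s : ℝ), b = (a ∘ T x) ∘ D.flow s})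
    (h : ∀ a ∈ S, ContinuousAt (fun t : ℝ => D.form a (a ∘ D.flow t)) 0) :
    D.IsStronglyContinuous := by
  -- the continuity domain of the group at `t = 0`, a linear subspace of `ℋ`
  let M : Submodule ℝ D.FluctuationSpace :=
    { carrier := {ψ | Tendsto (fun t : ℝ => D.koopman t ψ) (𝓝 0) (𝓝 ψ)}
      add_mem' := fun {ψ φ} hψ hφ => by
        simp only [mem_setOf_eq, map_add] at hψ hφ ⊢
        exact hψ.add hφ
      zero_mem' := by simp only [mem_setOf_eq, map_zero]; exact tendsto_const_nhds
      smul_mem' := fun c ψ hψ => by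
        simp only [mem_setOf_eq, LinearIsometryEquiv.map_smul] at hψ ⊢
        exact hψ.const_smul c }
  have hM : ∀ ψ : D.FluctuationSpace, ψ ∈ M ↔ Tendsto (fun t : ℝ => D.koopman t ψ) (𝓝 0) (𝓝 ψ) :=
    fun ψ => Iff.rfl
  -- `M` is invariant under every `U_s`
  have hMU : ∀ {ψ : D.FluctuationSpace}, ψ ∈ M → ∀ s : ℝ, D.koopman s ψ ∈ M := by
    intro ψ hψ s
    rw [hM] at hψ ⊢
    have h1 := ((D.koopman s).continuous.tendsto ψ).comp hψ
    refine h1.congr fun t => ?_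
    simp only [comp_apply, D.koopman_comm_apply s t]
  -- `M` contains the class of every generator
  have hMS : ∀ a ∈ S, D.fluct a ∈ M := by
    intro a haS
    rw [hM]
    refine D.tendsto_koopman_fluct (hS haS) ?_
    have h0 : D.form a (a ∘ D.flow 0) = D.form a a := by
      have e := FluctuationStructure.form_congr_ae (F := D.toFluctuationStructure)
        (EventuallyEq.rfl (f := a)) (D.flow_zero.fun_comp a)
      simpa [Function.comp_def] using e
    simpa [ContinuousAt, h0] using h a haS
  -- every `b = a ∘ T_x ∘ φ_s` is a local observable with class `U_s [a] ∈ M`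
  have hgenmem : ∀ b ∈ {b | ∃ a ∈ S, ∃ (x : G) (s : ℝ), b = (a ∘ T x) ∘ D.flow s},
      b ∈ D.localObs ∧ D.fluct b ∈ M := by
    rintro b ⟨a, haS, x, s, rfl⟩
    refine ⟨D.comp_flow_mem s (D.comp_shift_mem x (hS haS)), ?_⟩
    rw [D.fluct_comp_shift_comp_flow (hS haS) x s]
    exact hMU (hMS a haS) s
  -- hence so is every element of the span
  have hspan : ∀ b ∈ Submodule.span ℝ {b | ∃ a ∈ S, ∃ (x : G) (s : ℝ), b = (a ∘ T x) ∘ D.flow s},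
      b ∈ D.localObs ∧ D.fluct b ∈ M := by
    intro b hb
    induction hb using Submodule.span_induction with
    | mem b hb => exact hgenmem b hb
    | zero => exact ⟨D.localObs.zero_mem, by rw [FluctuationStructure.fluct_zero]; exact zero_mem _⟩
    | add b b' _ _ hb hb' =>
        refine ⟨D.localObs.add_mem hb.1 hb'.1, ?_⟩
        rw [FluctuationStructure.fluct_add hb.1 hb'.1]
        exact add_mem hb.2 hb'.2
    | smul c b _ hb =>
        refine ⟨D.localObs.smul_mem c hb.1, ?_⟩
        rw [FluctuationStructure.fluct_smul c hb.1]
        exact Submodule.smul_mem _ c hb.2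
  -- and the autocorrelation of every local observable is continuous at `0`
  refine D.isStronglyContinuous_of_tendsto_form fun b hb => ?_
  have hψ : Tendsto (fun t : ℝ => D.koopman t (D.fluct b)) (𝓝 0) (𝓝 (D.fluct b)) :=
    (hM _).1 (hspan b (hgen hb)).2
  have h2 : Tendsto (fun t : ℝ => ⟪D.fluct b, D.koopman t (D.fluct b)⟫_ℝ) (𝓝 0)
      (𝓝 ⟪D.fluct b, D.fluct b⟫_ℝ) :=
    (tendsto_const_nhds (x := D.fluct b)).inner hψ
  rw [FluctuationStructure.inner_fluct_fluct hb hb] at h2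
  refine h2.congr fun t => ?_
  exact D.inner_fluct_koopman_fluct t hb hb

end FluctuationDynamics

/-! ### The chain: strong continuity on `ℋ₀(μ)` from the autocorrelations of `j₀` and `h₀` -/

namespace HeatConduction

namespace ZeroWavenumberData

variable {P : OscillatorChain} {D : InfiniteChainDynamics P} (Z : ZeroWavenumberData P D)

/-- **Strong continuity of the Koopman group on Doyon's `ℋ₀(μ)` from two scalar functions.** If the
local observables of the zero-wavenumber data are spanned by the translates and time-evolutes of the
bond current `j₀` and the energy density `h₀`, and the two diagonal space-summed correlation functions
`t ↦ ⟨j₀, j₀ ∘ φ_t⟩₀ = Σ_x Cov_μ(j₀, j_x ∘ φ_t)` and `t ↦ ⟨h₀, h₀ ∘ φ_t⟩₀` are continuous at `t = 0`,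
then `t ↦ U_t ψ` is continuous for every `ψ ∈ ℋ₀(μ)` (the hypothesis of Stone's theorem, of
`FluctuationUnitaryGroup.unitaryGroup`, and of the positivity of the Abel functional). [folklore] -/
theorem isStronglyContinuous_of_generators
    (hgen : Z.localObs ≤ Submodule.span ℝ
      {b | ∃ a ∈ ({fun σ => P.bondCurrentZ σ 0, fun σ => P.energyDensityZ σ 0} : Set (ChainConfig → ℝ)),
        ∃ (x : ℤ) (s : ℝ), b = (a ∘ chainShift x) ∘ D.flow s})
    (hj : ContinuousAt (fun t : ℝ =>
      Z.form (fun σ => P.bondCurrentZ σ 0) ((fun σ => P.bondCurrentZ σ 0) ∘ D.flow t)) 0)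
    (hh : ContinuousAt (fun t : ℝ =>
      Z.form (fun σ => P.energyDensityZ σ 0) ((fun σ => P.energyDensityZ σ 0) ∘ D.flow t)) 0) :
    Z.toFluctuationDynamics.IsStronglyContinuous := by
  refine Z.toFluctuationDynamics.isStronglyContinuous_of_generators
    ({fun σ => P.bondCurrentZ σ 0, fun σ => P.energyDensityZ σ 0} : Set (ChainConfig → ℝ)) ?_ hgen ?_
  · intro a ha
    rcases ha with rfl | rfl
    · exact Z.bondCurrent_mem
    · exact Z.energyDensity_mem
  · intro a ha
    rcases ha with rfl | rfl
    · exact hj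
    · exact hh

end ZeroWavenumberData

end HeatConduction

end Literature.MathematicalPhysics.KineticTheory

end
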